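import Summits.Ventures.YMGap.RobustBall.FourPointMajorantS
import Summits.Ventures.YMGap.RobustBall.TreeLoadSumsS
import HarnessLib

/-!
# Venture YMGap, track ROBUST-BALL (Y2) — TIER 2: THE THIRD-ORDER SUSCEPTIBILITY OF A LOCAL OBSERVABLE IS AN ABSOLUTELY CONVERGENT TRIPLE SERIES, UNIFORMLY ON THE WEIGHTED BALL

HONEST FRAMING. WHAT THIS IS: a venture file (cell `pub-ymgap`, track Y2 ROBUST-BALL, seat rb-p1, theorems only).  Member `W ∈ MemBallZdS a Λ_t t` in the pair
door (`t > 0`), ANY DLR state `μ`, a bounded measurable local Frobenius-Lipschitz observable `F` (support `Λ_F`, vector `δ_F`) and ONE direction `V` of the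
ball (measurable bounded own-link terms `V_X` depending on `X`, Frobenius-Lipschitz witnesses with plain / size-weighted / size²-weighted per-link loads
`≤ L, L₂, L₃`); `u₄` = ds-1's derivative form of the fourth cumulant; `C_s = d((1+e^{−s/d})/(1−e^{−s/d}))^d`, `s = t/3`:
* ★★ `sum_abs_fourPoint_le_S` — for all finite families `T, T', T''`:
  `Σ_{X∈T} Σ_{Y∈T'} Σ_{Z∈T''} |u₄(F; V_X; V_Y; V_Z)| ≤ 4608 N² (Σδ_F) C_s³ #Λ_F L (#Λ_F² L² + 3 L L₃ + 6 L₂² + 6 #Λ_F L L₂)`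
  (`FourPointMajorantS` termwise + `TreeLoadSumsS`);
* ★★ `summable_abs_fourPoint_direction_S` — hence `(X, Y, Z) ↦ |u₄(F; V_X; V_Y; V_Z)|` is summable over ALL triples of finite link sets with the same
  bound on the sum: the third-order susceptibility of `F` against `V` exists as an absolutely convergent triple series, ONE bound for the whole ball;
* `su2_summable_abs_fourPoint_direction_dim4` — `SU(2)`, `ℤ⁴`, hypothesis-free door: `6|β_W|e^a e^t + e^{a/2}√(2/3) Λ < 1`.
This is the input of `C³` of the state map along the lines of the ball (`d/ds Σ_{X,Y} u₃ = −Σ_{X,Y,Z} u₄`, successor file).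
WHAT THIS IS NOT: one-sided Dobrushin-comparison constants at lattice strong coupling; nothing about the continuum limit or a Clay-sense mass gap.
-/

noncomputable section

open MeasureTheory Function Finset ProbabilityTheory Real
open scoped NNReal
open Literature.Probability.LatticeModels
open Literature.Probability.LatticeModels.DobrushinMetric
open Literature.MathematicalPhysics.QuantumLattice
open Literature.MathematicalPhysics.QuantumFieldTheory hiding ZdEdge
open Summit.QuantumFields.BalabanUV.InfraRed.StrongCouplingPoincareDoorSUN (oneLinkPoincareSUN_two_sharp)

namespace Summit.Ventures.YMGap.RobustBall

variable {d N : ℕ}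

/-- Local shorthand: the connected three-point function `u₃(X; Y; Z)` under `μ`. -/
local notation3 (prettyPrint := false) "U₃[" X ";" Y ";" Z ";" μ "]" =>
  cov[fun ω => X ω * Y ω, Z; μ] - (∫ ω, X ω ∂μ) * cov[Y, Z; μ] - (∫ ω, Y ω ∂μ) * cov[X, Z; μ]

/-- Local shorthand: the connected four-point function in derivative form `u₄(X; Y; Z; W)` under `μ`. -/
local notation3 (prettyPrint := false) "U₄[" X ";" Y ";" Z ";" W' ";" μ "]" =>
  (cov[fun ω => (X ω * Y ω) * Z ω, W'; μ] - (∫ ω, X ω * Y ω ∂μ) * cov[Z, W'; μ] - (∫ ω, Z ω ∂μ) * cov[fun ω => X ω * Y ω, W'; μ])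
  - cov[X, W'; μ] * cov[Y, Z; μ] - (∫ ω, X ω ∂μ) * U₃[Y ; Z ; W' ; μ]
  - cov[Y, W'; μ] * cov[X, Z; μ] - (∫ ω, Y ω ∂μ) * U₃[X ; Z ; W' ; μ]

section SUN

variable {W V : Potential (ZdEdge d) (Matrix.specialUnitaryGroup (Fin N) ℂ)}

/-- ★★ **PARTIAL SUMS OF THE THIRD-ORDER SUSCEPTIBILITY, uniformly on the weighted ball.**  Member `W ∈ MemBallZdS a Λ_t t` in the pair door (`t > 0`),
ANY DLR `μ`, `F` bounded measurable local Frobenius-Lipschitz, direction `V` with loads `≤ L, L₂, L₃` (plain, size-weighted, size²-weighted); then for all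
finite families `T, T', T''`: `Σ_X Σ_Y Σ_Z |u₄(F; V_X; V_Y; V_Z)| ≤ 4608 N² (Σδ_F) C_s³ #Λ_F L (#Λ_F² L² + 3 L L₃ + 6 L₂² + 6 #Λ_F L L₂)`, `s = t/3`. -/
theorem sum_abs_fourPoint_le_S (hd : 1 ≤ d) (hN : 1 ≤ N) {β b c v a Λt t : ℝ}
    (hc : 0 ≤ c) (hv : 0 ≤ v) (hb : |β| * (2 * ((d : ℝ) - 1)) ≤ b)
    (hP : ∀ B : Matrix (Fin N) (Fin N) ℂ, matrixOpNorm B ≤ b →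
      ∀ (ψ : Matrix.specialUnitaryGroup (Fin N) ℂ → ℝ) (M : ℝ), 0 ≤ M →
        (∀ x y, |ψ x - ψ y| ≤ M * suFrobDist x y) →
        Var[ψ; (haarProbability (Matrix.specialUnitaryGroup (Fin N) ℂ)).tilted
          fun g => (N : ℝ) * ((g : Matrix (Fin N) (Fin N) ℂ) * B).trace.re] ≤ c * M ^ 2)
    (hVB : ∀ B : Matrix (Fin N) (Fin N) ℂ, matrixOpNorm B ≤ b → ∀ Δ : Matrix (Fin N) (Fin N) ℂ,
      Var[fun g : Matrix.specialUnitaryGroup (Fin N) ℂ =>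
          (N : ℝ) * ((g : Matrix (Fin N) (Fin N) ℂ) * Δ).trace.re;
        (haarProbability (Matrix.specialUnitaryGroup (Fin N) ℂ)).tilted
          fun g => (N : ℝ) * ((g : Matrix (Fin N) (Fin N) ℂ) * B).trace.re] ≤ v * frobNorm Δ ^ 2)
    (ht : 0 < t) (hρ : 6 * ((d : ℝ) - 1) * |β| * (exp a * exp t * Real.sqrt (c * v)) + exp (a / 2) * Real.sqrt c * Λt < 1)
    (hW : MemBallZdS a Λt t W) {μ : Measure (LGConfig d (Matrix.specialUnitaryGroup (Fin N) ℂ))}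
    (hμ : μ ∈ perturbedGibbsMeasuresS (d := d) (fundamentalRep (Fin N)) (N * β) W)
    {F : LGConfig d (Matrix.specialUnitaryGroup (Fin N) ℂ) → ℝ} (hFm : Measurable F) {ΛF : Finset (ZdEdge d)}
    (hFdep : DependsOn F (↑ΛF : Set (ZdEdge d))) {MF : ℝ} (hMF : ∀ σ, |F σ| ≤ MF) {δF : ZdEdge d → ℝ} (hδF : IsLipBound suFrobDist F δF)
    (hVm : ∀ X, Measurable (V X)) (hVdep : ∀ X, DependsOn (V X) (↑X : Set (ZdEdge d))) (hVb : ∀ X, ∃ C, ∀ U, |V X U| ≤ C)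
    {lipV : Finset (ZdEdge d) → ZdEdge d → ℝ} (hlipV : ∀ X, IsLipBound suFrobDist (V X) (lipV X)) {L L₂ L₃ : ℝ}
    (hLs : ∀ e, Summable fun X : Finset (ZdEdge d) => (if e ∈ X then ∑ y ∈ X, lipV X y else 0))
    (hL : ∀ e, ∑' X : Finset (ZdEdge d), (if e ∈ X then ∑ y ∈ X, lipV X y else 0) ≤ L)
    (hL2s : ∀ e, Summable fun X : Finset (ZdEdge d) => (if e ∈ X then (X.card : ℝ) * ∑ y ∈ X, lipV X y else 0))
    (hL2 : ∀ e, ∑' X : Finset (ZdEdge d), (if e ∈ X then (X.card : ℝ) * ∑ y ∈ X, lipV X y else 0) ≤ L₂)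
    (hL3s : ∀ e, Summable fun X : Finset (ZdEdge d) => (if e ∈ X then (X.card : ℝ) ^ 2 * ∑ y ∈ X, lipV X y else 0))
    (hL3 : ∀ e, ∑' X : Finset (ZdEdge d), (if e ∈ X then (X.card : ℝ) ^ 2 * ∑ y ∈ X, lipV X y else 0) ≤ L₃)
    (T T' T'' : Finset (Finset (ZdEdge d))) :
    ∑ X ∈ T, ∑ Y ∈ T', ∑ Z ∈ T'', |U₄[F ; V X ; V Y ; V Z ; μ]| ≤
      4608 * N ^ 2 * (∑ y ∈ ΛF, δF y) *
        (((d : ℝ) * ((1 + exp (-(t / 3 / d))) / (1 - exp (-(t / 3 / d)))) ^ d) ^ 3 * ΛF.card * L *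
          ((ΛF.card : ℝ) ^ 2 * L ^ 2 + 3 * L * L₃ + 6 * L₂ ^ 2 + 6 * ΛF.card * L * L₂)) := by
  classical
  have hterm := fun X Y Z => abs_fourPoint_le_majorant_S hd hN hc hv hb hP hVB ht hρ hW hμ hFm hFdep hMF hδF hVm hVdep hVb hlipV
    rfl rfl rfl rfl X Y Z
  refine (sum_le_sum fun X _ => sum_le_sum fun Y _ => sum_le_sum fun Z _ => hterm X Y Z).trans ?_
  simp only [← Finset.mul_sum]
  have hNN : (0 : ℝ) ≤ N := Nat.cast_nonneg N
  have hS0 : 0 ≤ ∑ y ∈ ΛF, δF y := sum_nonneg fun y _ => hδF.nonneg y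
  have hK0 : 0 ≤ 4608 * (N : ℝ) ^ 2 * ∑ y ∈ ΛF, δF y := mul_nonneg (mul_nonneg (by norm_num) (pow_nonneg hNN 2)) hS0
  by_cases hF : ΛF.Nonempty
  · have hs : 0 < t / 3 := by positivity
    have hsum := sum_tree16_le_S hd hs hF (LX := fun X => ∑ y ∈ X, lipV X y) (fun X => sum_nonneg fun y _ => (hlipV X).nonneg y)
      (by simp) hLs hL hL2s hL2 hL3s hL3 (gD := fun Δ e => exp (-(t / 3) * linkSetDist Δ e)) rfl rfl T T' T''
    exact mul_le_mul_of_nonneg_left hsum hK0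
  · have h0 : ∑ y ∈ ΛF, δF y = 0 := by rw [Finset.not_nonempty_iff_eq_empty.1 hF, sum_empty]
    rw [h0]; simp

/-- ★★ **THE THIRD-ORDER SUSCEPTIBILITY IS AN ABSOLUTELY CONVERGENT TRIPLE SERIES, uniformly on the weighted ball.**  Under the hypotheses of
`sum_abs_fourPoint_le_S`, `(X, Y, Z) ↦ |u₄(F; V_X; V_Y; V_Z)|` is summable over ALL triples of finite link sets and
`Σ' |u₄| ≤ 4608 N² (Σδ_F) C_s³ #Λ_F L (#Λ_F² L² + 3 L L₃ + 6 L₂² + 6 #Λ_F L L₂)`. -/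
theorem summable_abs_fourPoint_direction_S (hd : 1 ≤ d) (hN : 1 ≤ N) {β b c v a Λt t : ℝ}
    (hc : 0 ≤ c) (hv : 0 ≤ v) (hb : |β| * (2 * ((d : ℝ) - 1)) ≤ b)
    (hP : ∀ B : Matrix (Fin N) (Fin N) ℂ, matrixOpNorm B ≤ b →
      ∀ (ψ : Matrix.specialUnitaryGroup (Fin N) ℂ → ℝ) (M : ℝ), 0 ≤ M →
        (∀ x y, |ψ x - ψ y| ≤ M * suFrobDist x y) →
        Var[ψ; (haarProbability (Matrix.specialUnitaryGroup (Fin N) ℂ)).tilted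
          fun g => (N : ℝ) * ((g : Matrix (Fin N) (Fin N) ℂ) * B).trace.re] ≤ c * M ^ 2)
    (hVB : ∀ B : Matrix (Fin N) (Fin N) ℂ, matrixOpNorm B ≤ b → ∀ Δ : Matrix (Fin N) (Fin N) ℂ,
      Var[fun g : Matrix.specialUnitaryGroup (Fin N) ℂ =>
          (N : ℝ) * ((g : Matrix (Fin N) (Fin N) ℂ) * Δ).trace.re;
        (haarProbability (Matrix.specialUnitaryGroup (Fin N) ℂ)).tilted
          fun g => (N : ℝ) * ((g : Matrix (Fin N) (Fin N) ℂ) * B).trace.re] ≤ v * frobNorm Δ ^ 2)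
    (ht : 0 < t) (hρ : 6 * ((d : ℝ) - 1) * |β| * (exp a * exp t * Real.sqrt (c * v)) + exp (a / 2) * Real.sqrt c * Λt < 1)
    (hW : MemBallZdS a Λt t W) {μ : Measure (LGConfig d (Matrix.specialUnitaryGroup (Fin N) ℂ))}
    (hμ : μ ∈ perturbedGibbsMeasuresS (d := d) (fundamentalRep (Fin N)) (N * β) W)
    {F : LGConfig d (Matrix.specialUnitaryGroup (Fin N) ℂ) → ℝ} (hFm : Measurable F) {ΛF : Finset (ZdEdge d)}
    (hFdep : DependsOn F (↑ΛF : Set (ZdEdge d))) {MF : ℝ} (hMF : ∀ σ, |F σ| ≤ MF) {δF : ZdEdge d → ℝ} (hδF : IsLipBound suFrobDist F δF)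
    (hVm : ∀ X, Measurable (V X)) (hVdep : ∀ X, DependsOn (V X) (↑X : Set (ZdEdge d))) (hVb : ∀ X, ∃ C, ∀ U, |V X U| ≤ C)
    {lipV : Finset (ZdEdge d) → ZdEdge d → ℝ} (hlipV : ∀ X, IsLipBound suFrobDist (V X) (lipV X)) {L L₂ L₃ : ℝ}
    (hLs : ∀ e, Summable fun X : Finset (ZdEdge d) => (if e ∈ X then ∑ y ∈ X, lipV X y else 0))
    (hL : ∀ e, ∑' X : Finset (ZdEdge d), (if e ∈ X then ∑ y ∈ X, lipV X y else 0) ≤ L)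
    (hL2s : ∀ e, Summable fun X : Finset (ZdEdge d) => (if e ∈ X then (X.card : ℝ) * ∑ y ∈ X, lipV X y else 0))
    (hL2 : ∀ e, ∑' X : Finset (ZdEdge d), (if e ∈ X then (X.card : ℝ) * ∑ y ∈ X, lipV X y else 0) ≤ L₂)
    (hL3s : ∀ e, Summable fun X : Finset (ZdEdge d) => (if e ∈ X then (X.card : ℝ) ^ 2 * ∑ y ∈ X, lipV X y else 0))
    (hL3 : ∀ e, ∑' X : Finset (ZdEdge d), (if e ∈ X then (X.card : ℝ) ^ 2 * ∑ y ∈ X, lipV X y else 0) ≤ L₃) :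
    Summable (fun p : Finset (ZdEdge d) × (Finset (ZdEdge d) × Finset (ZdEdge d)) => |U₄[F ; V p.1 ; V p.2.1 ; V p.2.2 ; μ]|) ∧
      ∑' p : Finset (ZdEdge d) × (Finset (ZdEdge d) × Finset (ZdEdge d)), |U₄[F ; V p.1 ; V p.2.1 ; V p.2.2 ; μ]| ≤
      4608 * N ^ 2 * (∑ y ∈ ΛF, δF y) *
        (((d : ℝ) * ((1 + exp (-(t / 3 / d))) / (1 - exp (-(t / 3 / d)))) ^ d) ^ 3 * ΛF.card * L *
          ((ΛF.card : ℝ) ^ 2 * L ^ 2 + 3 * L * L₃ + 6 * L₂ ^ 2 + 6 * ΛF.card * L * L₂)) := by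
  classical
  -- every finite set of triples sits inside a product of its projections
  have hpartial : ∀ S : Finset (Finset (ZdEdge d) × (Finset (ZdEdge d) × Finset (ZdEdge d))), ∑ p ∈ S, |U₄[F ; V p.1 ; V p.2.1 ; V p.2.2 ; μ]| ≤
      4608 * N ^ 2 * (∑ y ∈ ΛF, δF y) *
        (((d : ℝ) * ((1 + exp (-(t / 3 / d))) / (1 - exp (-(t / 3 / d)))) ^ d) ^ 3 * ΛF.card * L *
          ((ΛF.card : ℝ) ^ 2 * L ^ 2 + 3 * L * L₃ + 6 * L₂ ^ 2 + 6 * ΛF.card * L * L₂)) := by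
    intro S
    have hsub : S ⊆ S.image Prod.fst ×ˢ (S.image (fun p => p.2.1) ×ˢ S.image (fun p => p.2.2)) := fun p hp =>
      Finset.mem_product.2 ⟨Finset.mem_image_of_mem _ hp,
        Finset.mem_product.2 ⟨Finset.mem_image_of_mem (fun p => p.2.1) hp, Finset.mem_image_of_mem (fun p => p.2.2) hp⟩⟩
    refine (Finset.sum_le_sum_of_subset_of_nonneg hsub fun _ _ _ => abs_nonneg _).trans ?_
    rw [Finset.sum_product]
    simp only [Finset.sum_product]
    exact sum_abs_fourPoint_le_S hd hN hc hv hb hP hVB ht hρ hW hμ hFm hFdep hMF hδF hVm hVdep hVb hlipV hLs hL hL2s hL2 hL3s hL3 _ _ _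
  exact ⟨summable_of_sum_le (fun _ => abs_nonneg _) hpartial, Real.tsum_le_of_sum_le (fun _ => abs_nonneg _) hpartial⟩

end SUN

/-! ### `SU(2)`, `ℤ⁴`, hypothesis-free -/

/-- **`SU(2)`, `ℤ⁴` — FINITE THIRD-ORDER SUSCEPTIBILITY OF EVERY LIPSCHITZ CYLINDER AGAINST A DIRECTION OF FINITE (SIZE- AND SIZE²-WEIGHTED) LOAD,
uniformly on `MemBallZdS a Λ t`.**  `0 < t`, `6|β_W| e^{a} e^{t} + e^{a/2} √(2/3) Λ < 1` ⇒ for every member `W` (bare coupling `β_W/2`), EVERY DLR `μ`,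
every Lipschitz cylinder `F` and every direction `V` (measurable bounded own-link terms, Lipschitz witnesses of loads `≤ L, L₂, L₃` through every
link): `(X, Y, Z) ↦ |u₄(F; V_X; V_Y; V_Z)|` is summable over all triples and
`Σ' |u₄| ≤ 18432 (#Λ_F K_F) C³ #Λ_F L (#Λ_F² L² + 3 L L₃ + 6 L₂² + 6 #Λ_F L L₂)`, `C = 4((1+e^{−t/12})/(1−e^{−t/12}))⁴`. -/
theorem su2_summable_abs_fourPoint_direction_dim4 {βW a Λ t : ℝ} (ht : 0 < t)
    (hρ : 6 * |βW| * (exp a * exp t) + exp (a / 2) * Real.sqrt (2 / 3) * Λ < 1)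
    {W V : Potential (ZdEdge 4) (Matrix.specialUnitaryGroup (Fin 2) ℂ)} (hW : MemBallZdS a Λ t W)
    {μ : Measure (LGConfig 4 (Matrix.specialUnitaryGroup (Fin 2) ℂ))}
    (hμ : μ ∈ perturbedGibbsMeasuresS (d := 4) (fundamentalRep (Fin 2)) (2 * (βW / 4)) W)
    {F : LGConfig 4 (Matrix.specialUnitaryGroup (Fin 2) ℂ) → ℝ} {ΛF : Finset (ZdEdge 4)} {KF : ℝ≥0}
    (hF : IsLipschitzCylinder (fundamentalRep (Fin 2)) F ΛF KF)
    (hVm : ∀ X, Measurable (V X)) (hVdep : ∀ X, DependsOn (V X) (↑X : Set (ZdEdge 4))) (hVb : ∀ X, ∃ C, ∀ U, |V X U| ≤ C)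
    {lipV : Finset (ZdEdge 4) → ZdEdge 4 → ℝ} (hlipV : ∀ X, IsLipBound suFrobDist (V X) (lipV X)) {L L₂ L₃ : ℝ}
    (hLs : ∀ e, Summable fun X : Finset (ZdEdge 4) => (if e ∈ X then ∑ y ∈ X, lipV X y else 0))
    (hL : ∀ e, ∑' X : Finset (ZdEdge 4), (if e ∈ X then ∑ y ∈ X, lipV X y else 0) ≤ L)
    (hL2s : ∀ e, Summable fun X : Finset (ZdEdge 4) => (if e ∈ X then (X.card : ℝ) * ∑ y ∈ X, lipV X y else 0))
    (hL2 : ∀ e, ∑' X : Finset (ZdEdge 4), (if e ∈ X then (X.card : ℝ) * ∑ y ∈ X, lipV X y else 0) ≤ L₂)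
    (hL3s : ∀ e, Summable fun X : Finset (ZdEdge 4) => (if e ∈ X then (X.card : ℝ) ^ 2 * ∑ y ∈ X, lipV X y else 0))
    (hL3 : ∀ e, ∑' X : Finset (ZdEdge 4), (if e ∈ X then (X.card : ℝ) ^ 2 * ∑ y ∈ X, lipV X y else 0) ≤ L₃) :
    Summable (fun p : Finset (ZdEdge 4) × (Finset (ZdEdge 4) × Finset (ZdEdge 4)) => |U₄[F ; V p.1 ; V p.2.1 ; V p.2.2 ; μ]|) ∧
      ∑' p : Finset (ZdEdge 4) × (Finset (ZdEdge 4) × Finset (ZdEdge 4)), |U₄[F ; V p.1 ; V p.2.1 ; V p.2.2 ; μ]| ≤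
      18432 * (ΛF.card * KF) *
        ((4 * ((1 + exp (-(t / 12))) / (1 - exp (-(t / 12)))) ^ 4) ^ 3 * ΛF.card * L *
          ((ΛF.card : ℝ) ^ 2 * L ^ 2 + 3 * L * L₃ + 6 * L₂ ^ 2 + 6 * ΛF.card * L * L₂)) := by
  classical
  have hc : (0 : ℝ) ≤ 2 / 3 := by norm_num
  have hP : ∀ B : Matrix (Fin 2) (Fin 2) ℂ, matrixOpNorm B ≤ |βW / 4| * (2 * (((4 : ℕ) : ℝ) - 1)) →
      ∀ (ψ : Matrix.specialUnitaryGroup (Fin 2) ℂ → ℝ) (M : ℝ), 0 ≤ M →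
        (∀ x y, |ψ x - ψ y| ≤ M * suFrobDist x y) →
        Var[ψ; (haarProbability (Matrix.specialUnitaryGroup (Fin 2) ℂ)).tilted
          fun g => ((2 : ℕ) : ℝ) * ((g : Matrix (Fin 2) (Fin 2) ℂ) * B).trace.re] ≤ 2 / 3 * M ^ 2 :=
    fun B hB ψ M hM hψ => oneLinkPoincareSUN_two_sharp _ B hB ψ M hM hψ
  have hVB := linVariance_of_poincare (N := 2) hP
  have hv : (0 : ℝ) ≤ 2 / 3 * ((2 : ℕ) : ℝ) ^ 2 := by norm_num
  have hsq : Real.sqrt (2 / 3 * (2 / 3 * ((2 : ℕ) : ℝ) ^ 2)) = 4 / 3 := by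
    rw [show (2 / 3 * (2 / 3 * ((2 : ℕ) : ℝ) ^ 2) : ℝ) = (4 / 3) ^ 2 by norm_num, Real.sqrt_sq (by norm_num)]
  have hρ' : 6 * (((4 : ℕ) : ℝ) - 1) * |βW / 4| * (exp a * exp t * Real.sqrt (2 / 3 * (2 / 3 * ((2 : ℕ) : ℝ) ^ 2))) +
      exp (a / 2) * Real.sqrt (2 / 3) * Λ < 1 := by
    rw [hsq, abs_div, abs_of_pos (by norm_num : (0 : ℝ) < 4)]
    have : 6 * (((4 : ℕ) : ℝ) - 1) * (|βW| / 4) * (exp a * exp t * (4 / 3)) = 6 * |βW| * (exp a * exp t) := by norm_num; ring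
    rw [this]; exact hρ
  have hμ' : μ ∈ perturbedGibbsMeasuresS (d := 4) (fundamentalRep (Fin 2)) ((2 : ℕ) * (βW / 4)) W := by simpa using hμ
  have hA : ∀ a b : Matrix.specialUnitaryGroup (Fin 2) ℂ, dist (suEntries a) (suEntries b) ≤ 1 * suFrobDist a b :=
    fun a b => by rw [one_mul]; exact dist_suEntries_le_suFrobDist a b
  have key := summable_abs_fourPoint_direction_S (N := 2) (d := 4) (by norm_num) (by norm_num) hc hv le_rfl hP hVB ht hρ' hW hμ' hF.measurable
    hF.dependsOn hF.abs_le (hF.isLipBound zero_le_one hA) hVm hVdep hVb hlipV hLs hL hL2s hL2 hL3s hL3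
  refine ⟨key.1, key.2.trans (le_of_eq ?_)⟩
  have hsumF : ∑ y ∈ ΛF, (if y ∈ ΛF then (1 : ℝ) * (KF : ℝ) else 0) = ΛF.card * KF := by
    rw [Finset.sum_congr rfl fun y hy => by rw [if_pos hy, one_mul], Finset.sum_const, nsmul_eq_mul]
  rw [hsumF, show (t / 3 / ((4 : ℕ) : ℝ)) = t / 12 by push_cast; ring]
  norm_num

end Summit.Ventures.YMGap.RobustBall

end
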